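import Literature.AlgebraicGeometry.Frobenioids.BiratFrobeniusCompactCriterion
import Literature.AlgebraicGeometry.Frobenioids.PadicFrobenioidRationallyStandard
import Literature.AlgebraicGeometry.Frobenioids.PadicFieldwiseSaturatedPrelim
import HarnessLib

/-!
# Frobenioids II, Theorem 1.2 (i), third sentence: every object of `(C^un-tr)^birat` of a `p`-adic Frobenioid is
# Frobenius-compact, and `C` IS of rationally standard type at THE parameters — PROOFS (row M17 closed)

Mochizuki, *The geometry of Frobenioids II: poly-Frobenioids*, Kyushu J. Math. **62** (2008) 401–460, §1,
Theorem 1.2 (i), kurims p. 9 l. 9–10: "If `D` is of FSMFF-type, then `C` is of rationally standard type"; proof,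
p. 9: "for `A_D ∈ Ob(D)`, the monoid `End_D(A_D)` acts trivially on `Φ(A_D)`" (Frobenius-compactness) and "the
homomorphism `B(A) → Φ^gp(A)` is nonzero". [cite: MochizukiFrdII2008, Thm 1.2 (i) p.9]
[FrdI] Def. 4.5 (iii)(b) p. 86 [cite: MochizukiFrdI2008, Def. 4.5 (iii) p.86].

PROOF-ONLY (theorems, no `def`; cell abc-iut, seat abc-iut-L6-t10 gen 3; row M17 "[FrdII] Thm 1.2 (i)
rationally-standard half" of this seat's lineage).  Seat abc-iut-L6-t10 gen 2's `PadicFrobenioidRationallyStandard.lean`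
reduced the row, at THE parameters `PreFrobenioid.rsParams hF PrimarySupp`, to the one input "`(C^un-tr)^birat`
admits a Frobenius-compact object" (`padic_isOfRationallyStandardType_rsParams_iff`,
`Thm12_i_standard_rsParams_of_frobCompact`).  This file supplies it by the generic criterion
`PreFrobenioid.Birat.untr_isFrobeniusCompact_of_invariant` (gen 3):
* `of_pow_ne_one` — `Div_B(f) = [c]`, `c ≠ 1` (gen 2's `exists_divB_eq_of`) is NON-TORSION in `Φ^gp(A_D)`
  (`Φ(A_D)` monoprime: sharp and integral);
* `untrBirat_isFrobeniusCompact` — **every object `[A]^birat` of `(C^un-tr)^birat` is Frobenius-compact**: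
  invariance of `Div_B(f)` under the base maps of automorphisms is "`End_D(A_D)` acts trivially on `Φ(A_D)`"
  (seat abc-iut-L1-d10's `endTrivial`, as `pullGp_endo`); `exists_isFrobeniusCompact_untrBirat` — Def. 4.5 (iii)(b);
* `untrBirat_isFrobeniusCompact_all` — the same for EVERY object of THE `(C^un-tr)^birat`;
* `isOfRationallyStandardType_rsParams` — **over an FSMFF-type base (with monoid data) the `p`-adic Frobenioid IS
  of rationally standard type at THE parameters**; `thm12_i_standard_rsParams` — the typed slot
  `Thm12_i_standard d V` for every binding `V` implied by Def. 4.5 (iii) at THE parameters;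
  `isOfRationallyStandardType_rsParams_of_isOfFSMType` / `thm12_i_standard_rsParams_of_isOfFSMType` — the same
  PREMISE-FREE over a base of FSM-type (seat abc-iut-L1-d10's `isMonoidData_of_isOfFSMType`).

Standard axioms only. Nothing here bears on [IUTchIII] Cor. 3.12 ([FrdII] is a refereed preparatory paper).
-/

noncomputable section

namespace Literature.AlgebraicGeometry.Frobenioids

open CategoryTheory Opposite Function

namespace PadicFrd

universe v u

variable {D : Type u} [Category.{v} D] {p : ℕ} [Fact p.Prime]

namespace Datum

variable (d : Datum D p)

/-- `[c]` with `c ≠ 1` is a NON-TORSION element of `Φ^gp(A_D)` (`Φ(A_D)` monoprime: sharp and integral).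
[cite: MochizukiFrdII2008, Thm 1.2 (i) p.9] -/
theorem of_pow_ne_one (A : Dᵒᵖ) {c : d.Φ.obj A} (hc : c ≠ 1) (N : ℕ) (hN : 0 < N) :
    Algebra.GrothendieckGroup.of c ^ N ≠ 1 := by
  intro h
  have hint := (d.isMonoprime A).isDivisorial.isPreDivisorial.isIntegral
  have hcN : c ^ N = 1 := hint.injective_of (by rw [map_pow, h, map_one])
  exact hc ((d.isMonoprime A).isDivisorial.isSharp.isTorsionFree.1 c N hN hcN)

/-! ### Def. 4.5 (iii)(b): every `[A]^birat ∈ (C^un-tr)^birat` is Frobenius-compact -/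

/-- **[FrdII] Thm. 1.2 (i), proof: every object `[A]^birat` of `(C^un-tr)^birat` is Frobenius-compact** —
"for `A_D ∈ Ob(D)`, the monoid `End_D(A_D)` acts trivially on `Φ(A_D)`" (so the base map of any automorphism of
`[A]^birat` fixes the non-torsion rational divisor `Div_B(f) ≠ 0`), under the monoid-data hypotheses making `C`
a Frobenioid; every object of `(C^un-tr)^birat` is such an image (all objects of `C` are isotropic).
[cite: MochizukiFrdII2008, Thm 1.2 (i) p.9] -/
theorem untrBirat_isFrobeniusCompact (h : d.IsMonoidData) (X : d.frobenioid) :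
    (PreFrobenioid.rsParams (d.isFrobenioid_of_isMonoidData h) fun a 𝔭 => PrimarySupp a 𝔭).BU.ops.IsFrobeniusCompact
      ((PreFrobenioid.rsParams (d.isFrobenioid_of_isMonoidData h) fun a 𝔭 => PrimarySupp a 𝔭).BU.toBirat.obj
        ((ModelFrobenioid.data d.Φ d.B d.divB).toUntr.obj
          ⟨X, (PreFrobenioidData.ofFunctor_isIsotropic d.structureFunctor X).mpr (d.thm12_isIsotropic X)⟩)) := by
  obtain ⟨f, c, hc, hfc⟩ := d.exists_divB_eq_of (op X.base)
  refine PreFrobenioid.Birat.untr_isFrobeniusCompact_of_invariant (d.isFrobenioid_of_isMonoidData h) _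
    (Frobenioids.divB d.Φ d.B d.divB (op X.base) f) ?_ ?_ ?_
  · exact (ModelFrobenioid.mem_biratSubgroup_iff_exists_divB d.objectwise_isGroupLike_B
      (fun Y => (d.isMonoprime (op Y)).isDivisorial) (d.isFrobenioid_of_isMonoidData h) X _).mpr ⟨f, rfl⟩
  · rw [hfc]
    exact d.of_pow_ne_one (op X.base) hc
  · exact fun g => d.pullGp_endo _ _

/-- **"every object of `(C^un-tr)^birat` is Frobenius-compact"**, literally: for EVERY object `Y` of THE
`(C^un-tr)^birat` of the `p`-adic Frobenioid (each is the image `[A]^birat` of the object `A := Y.as.obj` of `C`).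
[cite: MochizukiFrdII2008, Thm 1.2 (i) p.9] -/
theorem untrBirat_isFrobeniusCompact_all (h : d.IsMonoidData)
    (Y : (PreFrobenioid.rsParams (d.isFrobenioid_of_isMonoidData h) fun a 𝔭 => PrimarySupp a 𝔭).BU.Birat) :
    (PreFrobenioid.rsParams (d.isFrobenioid_of_isMonoidData h) fun a 𝔭 => PrimarySupp a 𝔭).BU.ops.IsFrobeniusCompact
      Y :=
  d.untrBirat_isFrobeniusCompact h (Y : (ModelFrobenioid.data d.Φ d.B d.divB).Untr).as.obj

/-- **Def. 4.5 (iii)(b) for the `p`-adic Frobenioid at THE `(C^un-tr)^birat`**: it admits a Frobenius-compact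
object (`D` is nonempty, being connected) — the one input left open by gen 2's reduction.
[cite: MochizukiFrdII2008, Thm 1.2 (i) p.9] -/
theorem exists_isFrobeniusCompact_untrBirat (h : d.IsMonoidData) :
    ∃ Y : (PreFrobenioid.rsParams (d.isFrobenioid_of_isMonoidData h) fun a 𝔭 => PrimarySupp a 𝔭).BU.Birat,
      (PreFrobenioid.rsParams (d.isFrobenioid_of_isMonoidData h) fun a 𝔭 => PrimarySupp a 𝔭).BU.ops.IsFrobeniusCompact
        Y := by
  haveI := d.isConnected_base
  obtain ⟨A⟩ := (inferInstance : Nonempty D)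
  exact ⟨_, d.untrBirat_isFrobeniusCompact h ⟨A, 1⟩⟩

/-! ### Theorem 1.2 (i): rationally standard type at THE parameters, unconditionally in the parameters -/

/-- **[FrdII] Thm. 1.2 (i): over an FSMFF-type base (with monoid data) the `p`-adic Frobenioid IS of rationally
standard type** ([FrdI] Def. 4.5 (iii)) at THE parameters `(C^birat, Supp, C^un-tr, (C^un-tr)^birat)`.
[cite: MochizukiFrdII2008, Thm 1.2 (i) p.9] -/
theorem isOfRationallyStandardType_rsParams (h : d.IsMonoidData) (hD : IsOfFSMFFType D) :
    (ModelFrobenioid.data d.Φ d.B d.divB).IsOfRationallyStandardType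
      (PreFrobenioid.rsParams (d.isFrobenioid_of_isMonoidData h) fun a 𝔭 => PrimarySupp a 𝔭) :=
  (d.padic_isOfRationallyStandardType_rsParams_iff h hD).mpr (d.exists_isFrobeniusCompact_untrBirat h)

/-- **[FrdII] Thm. 1.2 (i), third sentence, at the typed slot — the Frobenius-compact input supplied**: seat
abc-iut-L1-t4's `Thm12_i_standard d V` HOLDS for every vocabulary binding `V` whose "rationally standard" field is
implied by the Def. 4.5 (iii) statement at THE parameters (THE binding is of this shape), over a base with monoid
data. [cite: MochizukiFrdII2008, Thm 1.2 (i) p.9] -/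
theorem thm12_i_standard_rsParams (h : d.IsMonoidData) (V : Thm12Vocab d)
    (hV : (ModelFrobenioid.data d.Φ d.B d.divB).IsOfRationallyStandardType
        (PreFrobenioid.rsParams (d.isFrobenioid_of_isMonoidData h) fun a 𝔭 => PrimarySupp a 𝔭) →
      V.IsOfRationallyStandardType) :
    Thm12_i_standard d V :=
  d.Thm12_i_standard_rsParams_of_frobCompact h V hV (d.exists_isFrobeniusCompact_untrBirat h)

/-- **[FrdII] Thm. 1.2 (i) over a base of FSM-type, PREMISE-FREE**: the `p`-adic Frobenioid IS of rationally
standard type at THE parameters — the monoid-data premise is automatic over an FSM-type base (seat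
abc-iut-L1-d10's `isMonoidData_of_isOfFSMType`; FSM-type ⇒ FSMFF-type, `IsOfFSMType.isOfFSMFFType`; the cell's
reading of print's "FSMFF-type" as for [FrdI] Thm. 3.4 (ii) / Cor. 4.10). [cite: MochizukiFrdII2008, Thm 1.2 (i) p.9] -/
theorem isOfRationallyStandardType_rsParams_of_isOfFSMType (hD : IsOfFSMType D) :
    (ModelFrobenioid.data d.Φ d.B d.divB).IsOfRationallyStandardType
      (PreFrobenioid.rsParams (d.isFrobenioid_of_isMonoidData (d.isMonoidData_of_isOfFSMType hD))
        fun a 𝔭 => PrimarySupp a 𝔭) :=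
  d.isOfRationallyStandardType_rsParams (d.isMonoidData_of_isOfFSMType hD) hD.isOfFSMFFType

/-- **[FrdII] Thm. 1.2 (i), third sentence, at the typed slot over a base of FSM-type, PREMISE-FREE in the data**:
`Thm12_i_standard d V` for every binding `V` implied by Def. 4.5 (iii) at THE parameters.
[cite: MochizukiFrdII2008, Thm 1.2 (i) p.9] -/
theorem thm12_i_standard_rsParams_of_isOfFSMType (hD : IsOfFSMType D) (V : Thm12Vocab d)
    (hV : (ModelFrobenioid.data d.Φ d.B d.divB).IsOfRationallyStandardType
        (PreFrobenioid.rsParams (d.isFrobenioid_of_isMonoidData (d.isMonoidData_of_isOfFSMType hD))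
          fun a 𝔭 => PrimarySupp a 𝔭) →
      V.IsOfRationallyStandardType) :
    Thm12_i_standard d V :=
  d.thm12_i_standard_rsParams (d.isMonoidData_of_isOfFSMType hD) V hV

end Datum

end PadicFrd

end Literature.AlgebraicGeometry.Frobenioids

end
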